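import Literature.Topology.FourManifolds.CerfSphereGenericity
import Literature.Topology.FourManifolds.CerfCrossing
import Literature.Topology.FourManifolds.InvertedGermExtension
import HarnessLib

/-!
# The two stereographic charts of the sphere: transition by inversion, transfer of critical
# points, covering by the two closed unit discs (Cerf 1968, Ch. II §3, `V = S²`)

Topic `Literature/Topology/FourManifolds` (programme of the fact
`Literature.Topology.FourManifolds.cerf_pi0DiffDisc_relBoundary_three`, brick C1, structure layer).
Cerf (LNM 53 (1968), Ch. II §3) applies the genericity theory of §2 (functions on a compact
surface `V`) to `V = S²` through the height `ϖ ∘ j` of an embedding `j`.  In the tree the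
sphere is read in the two stereographic parametrisations `stereoInv s` of
`CerfSphereGenericity`; this file supplies what is needed to pass between them:

* the transition map is the inversion in the unit circle `x ↦ x / ‖x‖²`, the tree's
  `Literature.Topology.FourManifolds.sphereInversion`: `stereoInv b (sphereInversion x) = stereoInv a x`
  for `a ≠ b`, `x ≠ 0` (`stereoInv_inversion`), with invertible derivative off the origin
  (`fderiv_inversion_comp`);
* `fderiv_chart_eq_zero_iff` — **criticality of a point of the sphere for the height of an
  embedding does not depend on the chart**: the derivative of `x ↦ ϖ (E (stereoInv a x))`
  vanishes at `x ≠ 0` iff that of `y ↦ ϖ (E (stereoInv b y))` vanishes at `sphereInversion x`;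
  in the path format, `d1 (heightChart F a) (t, x) = 0 ↔ d1 (heightChart F b) (t, sphereInversion x) = 0`
  (`d1_heightChart_eq_zero_iff`), and the values agree (`heightChart_inversion`);
* `stereoInv_stereoProj`, `exists_stereoInv_eq_of_mem_sphere` — every point of the unit
  sphere is `stereoInv s x` with `‖x‖ ≤ 1` for one of the two charts (the closed unit discs
  parametrise the two closed hemispheres `ξ₂ ≤ 0`, `ξ₂ ≥ 0`).

## References
* [CerfDiffeoSphere1968] J. Cerf, *Sur les difféomorphismes de la sphère de dimension trois
  (Γ₄ = 0)*, LNM 53 (1968), Ch. II §3.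
-/

noncomputable section

open Set Function Filter Module Metric
open scoped ContDiff Topology BigOperators

namespace Literature.Topology.FourManifolds

namespace CerfPath

open Literature.Analysis.Calculus Literature.Analysis.Calculus.ParametricTransversality

/-- Local notation: the model plane. -/
local notation "𝔼²" => EuclideanSpace ℝ (Fin 2)
/-- Local notation: the ambient space. -/
local notation "𝔼³" => EuclideanSpace ℝ (Fin 3)

/-! ### The poles of the two charts -/

/-- The two charts have opposite poles. [folklore] -/
theorem pole_eq_neg_pole {a b : Fin 2} (hab : a ≠ b) : pole b = -pole a := by
  fin_cases a <;> fin_cases b <;> simp_all [pole]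

/-! ### The transition map: the inversion `x ↦ x / ‖x‖²` (the tree's `sphereInversion`) -/

/-- Components of the inversion in the unit circle. [folklore] -/
theorem sphereInversion_apply_coord (x : 𝔼²) (i : Fin 2) :
    sphereInversion x i = (‖x‖ ^ 2)⁻¹ * x i := by
  simp [sphereInversion.apply_def]

/-- `‖sphereInversion x‖² = 1/‖x‖²`. [folklore] -/
theorem norm_sq_sphereInversion (x : 𝔼²) : ‖sphereInversion x‖ ^ 2 = (‖x‖ ^ 2)⁻¹ := by
  rw [sphereInversion.norm_apply, inv_pow]

/-- **`D ι (ι y) ∘ D ι (y) = id`** for the inversion `ι` and `y ≠ 0` (differentiate the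
involution). [folklore] -/
theorem fderiv_inversion_comp {y : 𝔼²} (hy : y ≠ 0) :
    (fderiv ℝ (sphereInversion (F := 𝔼²)) (sphereInversion y)).comp
      (fderiv ℝ (sphereInversion (F := 𝔼²)) y) = ContinuousLinearMap.id ℝ 𝔼² := by
  have hy' : sphereInversion y ≠ 0 := sphereInversion.ne_zero hy
  have hd : DifferentiableAt ℝ (sphereInversion (F := 𝔼²)) y :=
    (sphereInversion.contDiffAt (n := ∞) hy).differentiableAt (by simp)
  have hd' : DifferentiableAt ℝ (sphereInversion (F := 𝔼²)) (sphereInversion y) :=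
    (sphereInversion.contDiffAt (n := ∞) hy').differentiableAt (by simp)
  have hid : (sphereInversion ∘ sphereInversion : 𝔼² → 𝔼²) = id :=
    funext fun z => sphereInversion.apply_apply z
  rw [← fderiv_comp y hd' hd, hid, fderiv_id]

/-- The derivative of the inversion at `x ≠ 0` is injective. [folklore] -/
theorem injective_fderiv_inversion {x : 𝔼²} (hx : x ≠ 0) :
    Injective (fderiv ℝ (sphereInversion (F := 𝔼²)) x) := by
  intro v w hvw
  have h := congrArg (fderiv ℝ (sphereInversion (F := 𝔼²)) (sphereInversion x)) hvw
  rw [← ContinuousLinearMap.comp_apply, ← ContinuousLinearMap.comp_apply, fderiv_inversion_comp hx]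
    at h
  simpa using h

/-- **The derivative of the inversion at `x ≠ 0` is onto** (it is its own inverse up to the base
point). [folklore] -/
theorem surjective_fderiv_inversion {x : 𝔼²} (hx : x ≠ 0) :
    Surjective (fderiv ℝ (sphereInversion (F := 𝔼²)) x) := by
  have hx' : sphereInversion x ≠ 0 := sphereInversion.ne_zero hx
  have h := fderiv_inversion_comp hx'
  rw [sphereInversion.apply_apply] at h
  intro w
  refine ⟨fderiv ℝ (sphereInversion (F := 𝔼²)) (sphereInversion x) w, ?_⟩
  have h' := congrArg (fun L : 𝔼² →L[ℝ] 𝔼² => L w) h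
  simpa using h'

/-- **The transition between the two charts is the inversion**: for `a ≠ b` and `x ≠ 0`,
`stereoInv b (sphereInversion x) = stereoInv a x`. [folklore] -/
theorem stereoInv_inversion {a b : Fin 2} (hab : a ≠ b) {x : 𝔼²} (hx : x ≠ 0) :
    stereoInv b (sphereInversion x) = stereoInv a x := by
  have hr : ‖x‖ ^ 2 ≠ 0 := pow_ne_zero 2 (norm_ne_zero_iff.2 hx)
  have hr1 : 1 + ‖x‖ ^ 2 ≠ 0 := (one_add_norm_sq_pos x).ne'
  have hp := pole_eq_neg_pole hab
  have hn := norm_sq_sphereInversion x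
  ext i
  fin_cases i
  · simp only [Fin.zero_eta, Fin.isValue]
    rw [stereoInv_apply_zero, stereoInv_apply_zero, hn, sphereInversion_apply_coord]
    field_simp
    ring
  · simp only [Fin.mk_one, Fin.isValue]
    rw [stereoInv_apply_one, stereoInv_apply_one, hn, sphereInversion_apply_coord]
    field_simp
    ring
  · simp only [Fin.reduceFinMk]
    rw [stereoInv_apply_two, stereoInv_apply_two, hn, hp]
    field_simp
    ring

/-! ### Criticality does not depend on the chart -/

section Transfer

variable {E : 𝔼³ → 𝔼³}

/-- The two chart readings of the height of `E` agree through the inversion: for `a ≠ b`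
and `x ≠ 0`, `ϖ (E (stereoInv a x)) = ϖ (E (stereoInv b (sphereInversion x)))`. [folklore] -/
theorem chart_height_eq {a b : Fin 2} (hab : a ≠ b) {x : 𝔼²} (hx : x ≠ 0) :
    (E (stereoInv a x)) 2 = (E (stereoInv b (sphereInversion x))) 2 := by
  rw [stereoInv_inversion hab hx]

/-- **Criticality of a point of the sphere for the height of an embedding does not depend on
the chart**: for a differentiable `E`, `a ≠ b` and `x ≠ 0`, the derivative of
`x ↦ ϖ (E (stereoInv a x))` vanishes at `x` iff that of `y ↦ ϖ (E (stereoInv b y))` vanishes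
at `sphereInversion x`. [cite: CerfDiffeoSphere1968, Ch. II §3 (`ϖ ∘ j` read in charts)] -/
theorem fderiv_chart_eq_zero_iff (hE : Differentiable ℝ E) {a b : Fin 2} (hab : a ≠ b)
    {x : 𝔼²} (hx : x ≠ 0) :
    fderiv ℝ (fun x => (E (stereoInv a x)) 2) x = 0 ↔
      fderiv ℝ (fun y => (E (stereoInv b y)) 2) (sphereInversion x) = 0 := by
  have hπ : Differentiable ℝ fun X : 𝔼³ => X 2 := by fun_prop
  have hgb : Differentiable ℝ fun y => (E (stereoInv b y)) 2 :=
    hπ.comp (hE.comp ((contDiff_stereoInv b).differentiable (by simp)))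
  have hinv : DifferentiableAt ℝ (sphereInversion (F := 𝔼²)) x :=
    (sphereInversion.contDiffAt (n := ∞) hx).differentiableAt (by simp)
  -- near `x` the first reading is the second composed with the inversion
  have heq : (fun x => (E (stereoInv a x)) 2) =ᶠ[𝓝 x]
      (fun y => (E (stereoInv b y)) 2) ∘ sphereInversion := by
    filter_upwards [isOpen_ne.mem_nhds hx] with y hy
    simp only [Function.comp_apply]
    rw [stereoInv_inversion hab hy]
  rw [heq.fderiv_eq, fderiv_comp x (hgb _) hinv]
  constructor
  · intro h
    ext w
    obtain ⟨v, rfl⟩ := surjective_fderiv_inversion hx w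
    have := congrArg (fun L : 𝔼² →L[ℝ] ℝ => L v) h
    simpa using this
  · intro h
    rw [h, ContinuousLinearMap.zero_comp]

variable {F : ℝ → 𝔼³ → 𝔼³}

/-- The chart readings of the height of a moving sphere agree through the inversion.
[folklore] -/
theorem heightChart_inversion {a b : Fin 2} (hab : a ≠ b) (t : ℝ) {x : 𝔼²} (hx : x ≠ 0) :
    heightChart F a (t, x) = heightChart F b (t, sphereInversion x) := by
  simp only [heightChart, chartMap_apply]
  rw [stereoInv_inversion hab hx]

/-- **Critical chart points transfer between the charts**: for a jointly smooth family, `a ≠ b`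
and `x ≠ 0`, `(t, x)` is critical for the slice of `heightChart F a` iff `(t, sphereInversion x)` is
critical for the slice of `heightChart F b`. [cite: CerfDiffeoSphere1968, Ch. II §3] -/
theorem d1_heightChart_eq_zero_iff (hF : ContDiff ℝ ∞ (uncurry F)) {a b : Fin 2} (hab : a ≠ b)
    (t : ℝ) {x : 𝔼²} (hx : x ≠ 0) :
    d1 (heightChart F a) (t, x) = 0 ↔ d1 (heightChart F b) (t, sphereInversion x) = 0 := by
  have hda : DifferentiableAt ℝ (heightChart F a) (t, x) :=
    (contDiff_heightChart hF a).differentiable (by simp) _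
  have hdb : DifferentiableAt ℝ (heightChart F b) (t, sphereInversion x) :=
    (contDiff_heightChart hF b).differentiable (by simp) _
  rw [← fderiv_slice_eq_zero_iff hda, ← fderiv_slice_eq_zero_iff hdb]
  have hE : Differentiable ℝ (F t) := (contDiff_member_of_uncurry hF t).differentiable (by simp)
  exact fderiv_chart_eq_zero_iff hE hab hx

end Transfer

/-! ### Covering of the sphere by the two closed unit discs -/

/-- The stereographic projection of a point of the unit sphere with `pole s · ξ₂ ≠ 1` has
`‖stereoProj s ξ‖² (1 - pole s ξ₂) = 1 + pole s ξ₂`. [folklore] -/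
theorem norm_sq_stereoProj_mul (s : Fin 2) {ξ : 𝔼³} (hξ : ‖ξ‖ = 1) (hne : 1 - pole s * ξ 2 ≠ 0) :
    ‖stereoProj s ξ‖ ^ 2 * (1 - pole s * ξ 2) = 1 + pole s * ξ 2 := by
  have h3 := norm_sq_eq_three ξ
  rw [hξ, one_pow] at h3
  have hp := pole_mul_self s
  have hc : (1 - pole s * ξ 2)⁻¹ * (1 - pole s * ξ 2) = 1 := inv_mul_cancel₀ hne
  have hc0 : stereoProj s ξ 0 = (1 - pole s * ξ 2)⁻¹ * ξ 0 := by simp [stereoProj]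
  have hc1 : stereoProj s ξ 1 = (1 - pole s * ξ 2)⁻¹ * ξ 1 := by simp [stereoProj]
  have key : ξ 0 ^ 2 + ξ 1 ^ 2 = (1 - pole s * ξ 2) * (1 + pole s * ξ 2) := by
    linear_combination -h3 + ξ 2 ^ 2 * hp
  rw [norm_sq_eq_two, hc0, hc1]
  calc (((1 - pole s * ξ 2)⁻¹ * ξ 0) ^ 2 + ((1 - pole s * ξ 2)⁻¹ * ξ 1) ^ 2) * (1 - pole s * ξ 2)
      = (1 - pole s * ξ 2)⁻¹ * ((1 - pole s * ξ 2)⁻¹ * (1 - pole s * ξ 2)) *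
          (ξ 0 ^ 2 + ξ 1 ^ 2) := by ring
    _ = (1 - pole s * ξ 2)⁻¹ * ((1 - pole s * ξ 2) * (1 + pole s * ξ 2)) := by
          rw [hc, key]; ring
    _ = ((1 - pole s * ξ 2)⁻¹ * (1 - pole s * ξ 2)) * (1 + pole s * ξ 2) := by ring
    _ = 1 + pole s * ξ 2 := by rw [hc, one_mul]

/-- **`stereoInv s ∘ stereoProj s = id` on the unit sphere off the pole.** [folklore] -/
theorem stereoInv_stereoProj (s : Fin 2) {ξ : 𝔼³} (hξ : ‖ξ‖ = 1) (hne : 1 - pole s * ξ 2 ≠ 0) :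
    stereoInv s (stereoProj s ξ) = ξ := by
  have hp := pole_mul_self s
  have hr := norm_sq_stereoProj_mul s hξ hne
  have hc : (1 - pole s * ξ 2)⁻¹ * (1 - pole s * ξ 2) = 1 := inv_mul_cancel₀ hne
  have hc0 : stereoProj s ξ 0 = (1 - pole s * ξ 2)⁻¹ * ξ 0 := by simp [stereoProj]
  have hc1 : stereoProj s ξ 1 = (1 - pole s * ξ 2)⁻¹ * ξ 1 := by simp [stereoProj]
  -- `‖x‖²` and `1 + ‖x‖²` in terms of `ξ₂`
  have hn : ‖stereoProj s ξ‖ ^ 2 = (1 + pole s * ξ 2) * (1 - pole s * ξ 2)⁻¹ := by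
    calc ‖stereoProj s ξ‖ ^ 2
        = ‖stereoProj s ξ‖ ^ 2 * ((1 - pole s * ξ 2) * (1 - pole s * ξ 2)⁻¹) := by
            rw [mul_inv_cancel₀ hne, mul_one]
      _ = (‖stereoProj s ξ‖ ^ 2 * (1 - pole s * ξ 2)) * (1 - pole s * ξ 2)⁻¹ := by ring
      _ = (1 + pole s * ξ 2) * (1 - pole s * ξ 2)⁻¹ := by rw [hr]
  have h1r : 1 + ‖stereoProj s ξ‖ ^ 2 = 2 * (1 - pole s * ξ 2)⁻¹ := by
    calc 1 + ‖stereoProj s ξ‖ ^ 2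
        = (1 - pole s * ξ 2)⁻¹ * (1 - pole s * ξ 2) + (1 + pole s * ξ 2) * (1 - pole s * ξ 2)⁻¹ := by
            rw [hc, hn]
      _ = 2 * (1 - pole s * ξ 2)⁻¹ := by ring
  have h2ne : (2 : ℝ) * (1 - pole s * ξ 2)⁻¹ ≠ 0 := mul_ne_zero two_ne_zero (inv_ne_zero hne)
  have h2c : (2 * (1 - pole s * ξ 2)⁻¹)⁻¹ * (2 * (1 - pole s * ξ 2)⁻¹) = 1 := inv_mul_cancel₀ h2ne
  ext i
  fin_cases i
  · simp only [Fin.zero_eta, Fin.isValue]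
    rw [stereoInv_apply_zero, h1r, hc0]
    calc (2 * (1 - pole s * ξ 2)⁻¹)⁻¹ * (2 * ((1 - pole s * ξ 2)⁻¹ * ξ 0))
        = ξ 0 * ((2 * (1 - pole s * ξ 2)⁻¹)⁻¹ * (2 * (1 - pole s * ξ 2)⁻¹)) := by ring
      _ = ξ 0 := by rw [h2c, mul_one]
  · simp only [Fin.mk_one, Fin.isValue]
    rw [stereoInv_apply_one, h1r, hc1]
    calc (2 * (1 - pole s * ξ 2)⁻¹)⁻¹ * (2 * ((1 - pole s * ξ 2)⁻¹ * ξ 1))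
        = ξ 1 * ((2 * (1 - pole s * ξ 2)⁻¹)⁻¹ * (2 * (1 - pole s * ξ 2)⁻¹)) := by ring
      _ = ξ 1 := by rw [h2c, mul_one]
  · simp only [Fin.reduceFinMk]
    rw [stereoInv_apply_two, h1r, hn]
    have hlin : (1 + pole s * ξ 2) * (1 - pole s * ξ 2)⁻¹ - 1 =
        2 * pole s * ξ 2 * (1 - pole s * ξ 2)⁻¹ := by
      linear_combination hc
    rw [hlin]
    calc (2 * (1 - pole s * ξ 2)⁻¹)⁻¹ * (pole s * (2 * pole s * ξ 2 * (1 - pole s * ξ 2)⁻¹))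
        = pole s * pole s * ξ 2 * ((2 * (1 - pole s * ξ 2)⁻¹)⁻¹ * (2 * (1 - pole s * ξ 2)⁻¹)) := by
            ring
      _ = ξ 2 := by rw [hp, h2c]; ring

/-- **The two closed unit discs cover the sphere**: every point of the unit sphere is
`stereoInv s x` with `‖x‖ ≤ 1` for `s = 0` (lower closed hemisphere `ξ₂ ≤ 0`) or `s = 1`
(upper closed hemisphere). [folklore] -/
theorem exists_stereoInv_eq_of_mem_sphere {ξ : 𝔼³} (hξ : ξ ∈ Metric.sphere (0 : 𝔼³) 1) :
    ∃ (s : Fin 2) (x : 𝔼²), ‖x‖ ≤ 1 ∧ stereoInv s x = ξ := by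
  rw [mem_sphere_zero_iff_norm] at hξ
  have h3 := norm_sq_eq_three ξ
  rw [hξ, one_pow] at h3
  have hξ2 : ξ 2 ^ 2 ≤ 1 := by nlinarith [sq_nonneg (ξ 0), sq_nonneg (ξ 1)]
  have hξ2' : -1 ≤ ξ 2 ∧ ξ 2 ≤ 1 := by
    constructor <;> nlinarith [sq_nonneg (ξ 2 - 1), sq_nonneg (ξ 2 + 1)]
  by_cases h : ξ 2 ≤ 0
  · -- chart `0`, pole `+1`
    have hne : 1 - pole 0 * ξ 2 ≠ 0 := by simp [pole]; linarith
    refine ⟨0, stereoProj 0 ξ, ?_, stereoInv_stereoProj 0 hξ hne⟩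
    have hr := norm_sq_stereoProj_mul 0 hξ hne
    have hle : ‖stereoProj 0 ξ‖ ^ 2 ≤ 1 := by
      have hpos : 0 < 1 - pole 0 * ξ 2 := by simp [pole]; linarith
      have : ‖stereoProj 0 ξ‖ ^ 2 * (1 - pole 0 * ξ 2) ≤ 1 * (1 - pole 0 * ξ 2) := by
        rw [hr, one_mul]; simp [pole]; linarith
      exact le_of_mul_le_mul_right this hpos
    nlinarith [norm_nonneg (stereoProj 0 ξ)]
  · -- chart `1`, pole `-1`
    push Not at h
    have hne : 1 - pole 1 * ξ 2 ≠ 0 := by simp [pole]; linarith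
    refine ⟨1, stereoProj 1 ξ, ?_, stereoInv_stereoProj 1 hξ hne⟩
    have hr := norm_sq_stereoProj_mul 1 hξ hne
    have hle : ‖stereoProj 1 ξ‖ ^ 2 ≤ 1 := by
      have hpos : 0 < 1 - pole 1 * ξ 2 := by simp [pole]; linarith
      have : ‖stereoProj 1 ξ‖ ^ 2 * (1 - pole 1 * ξ 2) ≤ 1 * (1 - pole 1 * ξ 2) := by
        rw [hr, one_mul]; simp [pole]; linarith
      exact le_of_mul_le_mul_right this hpos
    nlinarith [norm_nonneg (stereoProj 1 ξ)]

/-- `1 ≤ ‖sphereInversion x‖` when `0 < ‖x‖ ≤ 1`: a point of the closed unit disc of one chart,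
other than the centre, lies outside the open unit disc of the other chart (on the unit circle the
two chart coordinates coincide). [folklore] -/
theorem one_le_norm_inversion {x : 𝔼²} (hx : x ≠ 0) (hx1 : ‖x‖ ≤ 1) : 1 ≤ ‖sphereInversion x‖ :=
  (sphereInversion.one_le_norm_apply_iff hx).2 hx1

/-! ### Degeneracy does not depend on the chart (second-order transfer) -/

section SecondOrder

variable {f : ℝ × 𝔼² → ℝ}

/-- The derivative field of the slices: `sliceDeriv f λ x = D(f(λ, ·))(x)`. [folklore] -/
def sliceDeriv (f : ℝ × 𝔼² → ℝ) (t : ℝ) (x : 𝔼²) : 𝔼² →L[ℝ] ℝ := fderiv ℝ (fun x => f (t, x)) x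

/-- Unfolding of `sliceDeriv`. [folklore] -/
theorem sliceDeriv_apply (f : ℝ × 𝔼² → ℝ) (t : ℝ) (x : 𝔼²) :
    sliceDeriv f t x = fderiv ℝ (fun x => f (t, x)) x := rfl

/-- The slice derivative on a basis vector is Cerf's `p, q`. [folklore] -/
theorem sliceDeriv_apply_single (hf : Differentiable ℝ f) (t : ℝ) (x : 𝔼²) (i : Fin 2) :
    sliceDeriv f t x (EuclideanSpace.single i 1) = d1 f (t, x) i :=
  fderiv_slice_apply_single (z := (t, x)) (hf _) i

/-- The slice derivative vanishes iff the point is critical for the slice. [folklore] -/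
theorem sliceDeriv_eq_zero_iff (hf : Differentiable ℝ f) (t : ℝ) (x : 𝔼²) :
    sliceDeriv f t x = 0 ↔ d1 f (t, x) = 0 :=
  fderiv_slice_eq_zero_iff (z := (t, x)) (hf _)

/-- The slice derivative field is smooth. [folklore] -/
theorem contDiff_sliceDeriv (hf : ContDiff ℝ ∞ f) (t : ℝ) : ContDiff ℝ ∞ (sliceDeriv f t) := by
  have h : sliceDeriv f t = fun x => (fderiv ℝ f (t, x)).comp (ContinuousLinearMap.inr ℝ ℝ 𝔼²) :=
    fderiv_slice_eq (hf.differentiable (by simp)) t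
  rw [h]
  have h1 : ContDiff ℝ ∞ fun x : 𝔼² => fderiv ℝ f (t, x) := by
    have h2 := (hf.fderiv_right (m := ∞) (by simp)).comp
      (contDiff_const.prodMk contDiff_id : ContDiff ℝ ∞ fun x : 𝔼² => ((t, x) : ℝ × 𝔼²))
    exact h2
  exact h1.clm_comp contDiff_const

/-- **The derivative of the slice derivative field is the Hessian**: on basis vectors,
`D(sliceDeriv f λ)(x) v eᵢ = (Hess f_λ · v)ᵢ = hessMul f (λ, x) v i`. [folklore] -/
theorem fderiv_sliceDeriv_apply_single (hf : ContDiff ℝ ∞ f) (t : ℝ) (x v : 𝔼²) (i : Fin 2) :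
    fderiv ℝ (sliceDeriv f t) x v (EuclideanSpace.single i 1) = hessMul f (t, x) v i := by
  have hd : DifferentiableAt ℝ (sliceDeriv f t) x :=
    (contDiff_sliceDeriv hf t).differentiable (by simp) x
  -- evaluation at `eᵢ` commutes with differentiation
  have h1 : fderiv ℝ (fun x' => sliceDeriv f t x' (EuclideanSpace.single i 1)) x v =
      fderiv ℝ (sliceDeriv f t) x v (EuclideanSpace.single i 1) := by
    rw [(hd.hasFDerivAt.clm_apply (hasFDerivAt_const (EuclideanSpace.single i (1 : ℝ)) x)).fderiv]
    simp
  rw [← h1]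
  have hfun : (fun x' => sliceDeriv f t x' (EuclideanSpace.single i 1)) = fun x' => d1 f (t, x') i :=
    funext fun x' => sliceDeriv_apply_single (hf.differentiable (by simp)) t x' i
  rw [hfun]
  have hD : Differentiable ℝ fun z : ℝ × 𝔼² => d1 f z i := (contDiff_d1 hf i).differentiable (by simp)
  rw [(hasFDerivAt_slice (z := (t, x)) (hD (t, x)).hasFDerivAt).fderiv]
  simp only [ContinuousLinearMap.comp_apply, ContinuousLinearMap.inr_apply]
  exact fderiv_d1_apply_horizontal hf two_le_infty (t, x) v i

/-- **Nondegeneracy is injectivity of the derivative of the slice derivative field**: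
`δ ≠ 0` at `(λ, x)` iff `D(sliceDeriv f λ)(x)` is injective. [folklore] -/
theorem injective_fderiv_sliceDeriv_iff (hf : ContDiff ℝ ∞ f) (t : ℝ) (x : 𝔼²) :
    Injective (fderiv ℝ (sliceDeriv f t) x) ↔ hessDet f (t, x) ≠ 0 := by
  constructor
  · intro hinj hδ
    have hδ' : d2 f (t, x) 0 0 * d2 f (t, x) 1 1 - d2 f (t, x) 0 1 ^ 2 = 0 := hδ
    obtain ⟨k, hk, hk0, hk1⟩ := exists_kernel hδ'
    have hm : hessMul f (t, x) k = 0 := hessMul_kernel_eq_zero hf hk0 hk1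
    refine hk (hinj ?_)
    rw [map_zero, clm_eq_zero_iff_apply_single]
    intro i
    rw [fderiv_sliceDeriv_apply_single hf, hm, Pi.zero_apply]
  · intro hδ
    refine (injective_iff_map_eq_zero (fderiv ℝ (sliceDeriv f t) x)).2 fun v hv => ?_
    have hm : hessMul f (t, x) v = 0 := by
      funext i
      have h := congrArg (fun L : 𝔼² →L[ℝ] ℝ => L (EuclideanSpace.single i 1)) hv
      rw [fderiv_sliceDeriv_apply_single hf] at h
      exact h
    have hinj := injective_hessMul hf hδ
    refine (injective_iff_map_eq_zero _).1 hinj v ?_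
    ext i
    have h := congrFun hm i
    rw [hessMul] at h
    simpa [ContinuousLinearMap.pi_apply] using h

/-- **Conjugation of the Hessians through the chart transition.**  If the slices of `ga` and
`gb` are related by `ga(λ, y) = gb(λ, ι y)` off the origin (`ι = sphereInversion`) and
`(λ, ι x)` is critical for `gb`, then `D(sliceDeriv ga λ)(x) v = (D(sliceDeriv gb λ)(ι x) (M v)) ∘ M`
with `M = Dι(x)` invertible; hence one derivative is injective iff the other is.
[folklore] -/
theorem injective_fderiv_sliceDeriv_iff_of_inversion {ga gb : ℝ × 𝔼² → ℝ}
    (hgb : ContDiff ℝ ∞ gb) {t : ℝ} {x : 𝔼²} (hx : x ≠ 0)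
    (heq : ∀ y : 𝔼², y ≠ 0 → ga (t, y) = gb (t, sphereInversion y))
    (hcrit : sliceDeriv gb t (sphereInversion x) = 0) :
    Injective (fderiv ℝ (sliceDeriv ga t) x) ↔
      Injective (fderiv ℝ (sliceDeriv gb t) (sphereInversion x)) := by
  -- `M = D inversion (x)` and its inverse `M'`
  obtain ⟨M, hM⟩ : ∃ M : 𝔼² →L[ℝ] 𝔼², M = fderiv ℝ (sphereInversion (F := 𝔼²)) x := ⟨_, rfl⟩
  obtain ⟨M', hM'⟩ : ∃ M' : 𝔼² →L[ℝ] 𝔼²,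
      M' = fderiv ℝ (sphereInversion (F := 𝔼²)) (sphereInversion x) := ⟨_, rfl⟩
  have hx' : sphereInversion x ≠ 0 := sphereInversion.ne_zero hx
  have hM'M : ∀ v, M' (M v) = v := fun v => by
    have h := congrArg (fun L : 𝔼² →L[ℝ] 𝔼² => L v) (fderiv_inversion_comp hx)
    simpa [hM, hM'] using h
  have hMM' : ∀ w, M (M' w) = w := fun w => by
    have h := congrArg (fun L : 𝔼² →L[ℝ] 𝔼² => L w) (fderiv_inversion_comp hx')
    rw [sphereInversion.apply_apply] at h
    simpa [hM, hM'] using h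
  -- the slice derivative fields are conjugate near `x`
  have hgb1 : Differentiable ℝ fun y => gb (t, y) :=
    (hgb.comp (contDiff_const.prodMk contDiff_id)).differentiable (by simp)
  have hloc : sliceDeriv ga t =ᶠ[𝓝 x]
      fun x' => (sliceDeriv gb t (sphereInversion x')).comp
        (fderiv ℝ (sphereInversion (F := 𝔼²)) x') := by
    filter_upwards [isOpen_ne.mem_nhds hx] with x' hx'
    have he : (fun y => ga (t, y)) =ᶠ[𝓝 x'] (fun y => gb (t, y)) ∘ sphereInversion := by
      filter_upwards [isOpen_ne.mem_nhds hx'] with y hy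
      exact heq y hy
    have hinvd : DifferentiableAt ℝ (sphereInversion (F := 𝔼²)) x' :=
      (sphereInversion.contDiffAt (n := ∞) hx').differentiableAt (by simp)
    rw [sliceDeriv, he.fderiv_eq, fderiv_comp x' (hgb1 _) hinvd]
    rfl
  -- differentiate the conjugation formula at `x`
  have hΦb : DifferentiableAt ℝ (sliceDeriv gb t) (sphereInversion x) :=
    (contDiff_sliceDeriv hgb t).differentiable (by simp) _
  have hinvd : DifferentiableAt ℝ (sphereInversion (F := 𝔼²)) x :=
    (sphereInversion.contDiffAt (n := ∞) hx).differentiableAt (by simp)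
  have hcomp1 : HasFDerivAt (fun x' => sliceDeriv gb t (sphereInversion x'))
      ((fderiv ℝ (sliceDeriv gb t) (sphereInversion x)).comp M) x := by
    have h := hΦb.hasFDerivAt.comp x hinvd.hasFDerivAt
    rw [hM]; exact h
  have hMd : HasFDerivAt (fun x' => fderiv ℝ (sphereInversion (F := 𝔼²)) x')
      (fderiv ℝ (fderiv ℝ (sphereInversion (F := 𝔼²))) x) x := by
    have h1 : ContDiffAt ℝ 1 (fderiv ℝ (sphereInversion (F := 𝔼²))) x :=
      (sphereInversion.contDiffAt (n := 2) hx).fderiv_right (m := 1) (by norm_num)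
    exact (h1.differentiableAt (by norm_num)).hasFDerivAt
  have hprod := hcomp1.clm_comp hMd
  have happly : ∀ v, fderiv ℝ (sliceDeriv ga t) x v =
      ((fderiv ℝ (sliceDeriv gb t) (sphereInversion x)) (M v)).comp M := by
    intro v
    rw [hloc.fderiv_eq, hprod.fderiv]
    simp only [_root_.add_apply, ContinuousLinearMap.comp_apply,
      ContinuousLinearMap.compL_apply, ContinuousLinearMap.flip_apply, hcrit,
      ContinuousLinearMap.zero_comp, zero_add]
    rw [hM]
  constructor
  · intro hinj w₁ w₂ hw
    -- pull back through `M'`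
    have h : fderiv ℝ (sliceDeriv ga t) x (M' w₁) = fderiv ℝ (sliceDeriv ga t) x (M' w₂) := by
      rw [happly, happly, hMM', hMM', hw]
    have h' := hinj h
    have h'' := congrArg M h'
    rwa [hMM', hMM'] at h''
  · intro hinj v₁ v₂ hv
    rw [happly, happly] at hv
    have hT : (fderiv ℝ (sliceDeriv gb t) (sphereInversion x)) (M v₁) =
        (fderiv ℝ (sliceDeriv gb t) (sphereInversion x)) (M v₂) := by
      ext w
      have h := congrArg (fun L : 𝔼² →L[ℝ] ℝ => L (M' w)) hv
      simpa [hMM'] using h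
    have hMv : M v₁ = M v₂ := hinj hT
    have h := congrArg M' hMv
    rwa [hM'M, hM'M] at h

variable {F : ℝ → 𝔼³ → 𝔼³}

/-- **Degeneracy of a critical point of the sphere does not depend on the chart**: for a
jointly smooth family, `a ≠ b`, `x ≠ 0` and `(t, x)` critical for the slice of
`heightChart F a`, the Hessian determinant vanishes at `(t, x)` in chart `a` iff it vanishes at
`(t, sphereInversion x)` in chart `b`. [cite: CerfDiffeoSphere1968, Ch. II §3 (`ϖ ∘ j` read in charts)] -/
theorem hessDet_heightChart_eq_zero_iff (hF : ContDiff ℝ ∞ (uncurry F)) {a b : Fin 2}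
    (hab : a ≠ b) (t : ℝ) {x : 𝔼²} (hx : x ≠ 0) (hcrit : d1 (heightChart F a) (t, x) = 0) :
    hessDet (heightChart F a) (t, x) = 0 ↔ hessDet (heightChart F b) (t, sphereInversion x) = 0 := by
  have hga := contDiff_heightChart hF a
  have hgb := contDiff_heightChart hF b
  have hcb : d1 (heightChart F b) (t, sphereInversion x) = 0 :=
    (d1_heightChart_eq_zero_iff hF hab t hx).1 hcrit
  have hsb : sliceDeriv (heightChart F b) t (sphereInversion x) = 0 :=
    (sliceDeriv_eq_zero_iff (hgb.differentiable (by simp)) t (sphereInversion x)).2 hcb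
  have h := injective_fderiv_sliceDeriv_iff_of_inversion (ga := heightChart F a) hgb hx
    (fun y hy => heightChart_inversion hab t hy) hsb
  rw [injective_fderiv_sliceDeriv_iff hga, injective_fderiv_sliceDeriv_iff hgb] at h
  constructor
  · intro h0
    by_contra h1
    exact (h.2 h1) h0
  · intro h0
    by_contra h1
    exact (h.1 h1) h0

end SecondOrder

end CerfPath

end Literature.Topology.FourManifolds
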